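import Summits.QuantumFields.BalabanUV.T4Continuum.Support.NE7DataPathExp
import Summits.QuantumFields.BalabanUV.T4Continuum.Support.NE7DataExpChartGlobalGauge
import HarnessLib

/-!
# NE7OneStepOfSectorOpen — THE END OF GEN 67 FOR EVERY SMALL DATUM IN THE SECTOR: ONE-STEP ⇐ OPEN ∧ REP_w (in the global gauge) — PATH and the
# flat start are KERNEL, CLOSED is KERNEL, the gauge transfer is KERNEL

Cell `pub-balaban`, rung (B)+1 sub-cell t4, lineage `b2b-balaban-t4-ne7-p1`, generation 67 (CRUX PROVER NE7 #1); hunt (h11), memo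
`t4/b2b-balaban-t4-ne7-p1-g67/HUNT-H11-NORMAL-CURRENCY.md` §3–§5.  File F23 (over F21 `NE7DataPathExp`, F22 `NE7DataExpChartGlobalGauge`, F20, F18, F19).

WHAT ([folklore] composition; 0 def, 0 sorry).
**`oneStep_of_sector_open_repW`** (`d = 4`, `L ≥ 2`, `N ≥ 1`; class smallness, `LevelSmall` family, (P♮)_W with constant `CP` as in F20) and
**`oneStep_SU2_of_sector_open_repW`** (`L = 2`, `card n = 2`, `0 < ε ≤ 10⁻⁵³`, those three and the class smallness DISCHARGED): for a unitary `N`-periodic datum `V` with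
`SmallField V η` in the sector `|n|·N²·η ≤ sectorConst n`, the ONE-STEP binder of `NE7InteriorInduction.interior_exists_all_levels` (hence (8)∃ and route 1's
(A)-bill at this datum) follows from TWO displayed letters, both stated in the global gauge `u` of F22 (`V^u = e^{A}`, `A` skew periodic,
`‖A‖ ≤ gaugeConst n·(N⁻¹ + N·η)`) and universally over such `(u, A)`:
* (OPEN) at every level, along the exponential path `τ ↦ e^{τA}`: local continuation of an admissible, `SmallField · (δ(L^{k+1})^{−2})`, tangent-critical
  configuration with the radius KEPT — in any proof = the A-PRIORI ESTIMATE with margin ([Balaban1985Variational] Sect. F TYPE, LOCAL-FLAT (i)) + the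
  implicit-function continuation on the slice (non-degeneracy = F1 + (P♮)_W + the multiplier letter with a SMOOTH preimage, memo §2(ii));
* (REP_w) at every level at the datum `e^{A}`: every admissible, small, tangent-critical `U♯` represents every admissible competitor by a gauge-fixed chord
  with the WEIGHTED normal letters and F9's k-free line ([Balaban1985Variational] Prop. 2 ∕ B8 Thm 2 TYPE + the smooth-lift sizes).
Chain: F22 `exists_expChart_of_sector` (chart) → F21 `oneStep_of_expChart_open_repW` (F20: flat start `tanCritical_of_flat` + F18 continuity method with
CLOSED discharged + F19 CONV in the tangent currency) → F22 `oneStep_of_oneStep_gaugeAct` (back to `V`).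
HONEST FRAMING (page 1).  Composition; (OPEN) and (REP_w) carry ALL the analysis and are asserted for nothing; NOT ONE-STEP, NOT NE7; spine 0∕9; finite T⁴
rung (B)+1 — NOT infinite volume, NOT mass gap, NOT Clay.  Continuum YM on T⁴ ⇐ BetaPertH ∧ nine spine estimates (0/9 proved); BetaPertH ⇐ (D1) ∧ (D4) ∧
CAP+tail; G-an2-4 gates asym, D1 and NE2/3/4.
-/

set_option autoImplicit false

open scoped BigOperators Matrix Matrix.Norms.L2Operator Topology
open NormedSpace Finset Set Filter

namespace Summit.QuantumFields.BalabanUV.T4Continuum.NE7OneStepOfSectorOpen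

open Literature.MathematicalPhysics.QuantumFieldTheory.Balaban1983to89
open B7Prop1Explicit B7Prop2Explicit MatrixLog UnitaryModel
open T4AveragingDeficitWall (IsUnitaryCfg IsSkewDir SmallField vary curl curlSq dirSq flat_mem_classes)
open T4AveragingDeficitWallBoundary (IsPeriodicCfg periodBox)
open AveragingDeficitPeriodicCounting (IsPeriodicDir)
open AveragingDeficitMultiLevelPrep (tower LevelSmall TangentIter)
open MinimalActionLevels (levelAction perWin)
open MinimalActionSandwich (IsMinimiser admissible)
open MinimalActionRate (sfClass)
open MinimalActionWitness (flatCfg)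
open NE3HessForm (dAction)
open NE3SlicePoincareShape (SlicePoincare slicePoincare_mono)
open NE3FrameFreeSliceW (frameFreeBlockLandauW)
open NE3EnergyWeightedShapes (energyNormW)
open NE3SlicePoincareBudgetLine (CPLine)
open NE3EnergyShapes (IsUnitarySite IsPeriodicSite)
open NE3ClassRadiusFamily (classSlicePoincare_SU2' CPLine_nonneg_d4_L2)
open NE7ConvOneStepSU2 (levelSmall_all_d4_L2)
open TorusSmallFieldGlobalGauge (sectorConst gaugeConst)
open NE7OneStepOfPathOpen (flatCfg_mem_admissible classSmall_d4_L2)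
open NE7DataPathExp (oneStep_of_expChart_open_repW)
open NE7DataExpChartGlobalGauge (exists_expChart_of_sector oneStep_of_oneStep_gaugeAct)

noncomputable section

variable {n : Type*} [Fintype n] [DecidableEq n]

/-- **ONE-STEP ⇐ OPEN ∧ REP_w FOR EVERY SECTOR DATUM** (`d = 4`, `L ≥ 2`).  See the module docstring. [folklore] -/
theorem oneStep_of_sector_open_repW [Nonempty n] {L N : ℕ} [NeZero L] [NeZero N] (hL : 2 ≤ L) (hN : 1 ≤ N) {ε δ CP η : ℝ} (hε0 : 0 ≤ ε)
    (hε1 : 16 * C0 4 * ε ≤ 3) (hε2 : 1024 * ((4 : ℕ) + 1) * ((4 : ℕ) + 4) * (L : ℝ) ^ 2 * ε ≤ 1) (hδ : 0 ≤ δ) (hCP : 0 < CP)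
    (hls : ∀ k : ℕ, LevelSmall 4 L k (ε / ((L : ℝ) ^ (k + 1)) ^ 2))
    (hP : ∀ (j : ℕ) (W' : Site 4 → Fin 4 → (Matrix n n ℂ)ˣ), W' ∈ sfClass 4 L N ε (j + 1) →
      SlicePoincare L (j + 1) W' (frameFreeBlockLandauW L N (j + 1) W') CP (periodBox (d := 4) (N * L ^ (j + 1))))
    (hη : 0 ≤ η) (hsec : (Fintype.card n : ℝ) * (N : ℝ) ^ 2 * η ≤ sectorConst n)
    {V : Site 4 → Fin 4 → (Matrix n n ℂ)ˣ} (hVu : IsUnitaryCfg V) (hVP : IsPeriodicCfg V (N : ℤ)) (hVη : SmallField V η)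
    (hopen : ∀ (u : Site 4 → (Matrix n n ℂ)ˣ) (A : Site 4 → Fin 4 → Matrix n n ℂ), IsUnitarySite u → IsPeriodicSite u (N : ℤ) → IsSkewDir A →
      IsPeriodicDir A (N : ℤ) → (∀ (x : Site 4) (κ : Fin 4), ‖A x κ‖ ≤ gaugeConst n * (((N : ℝ))⁻¹ + (N : ℝ) * η)) →
      gaugeAct u V = vary (flatCfg : Site 4 → Fin 4 → (Matrix n n ℂ)ˣ) A 1 →
      ∀ (k : ℕ), ∀ τ₀ ∈ Icc (0 : ℝ) 1,
        (∃ U : Site 4 → Fin 4 → (Matrix n n ℂ)ˣ, U ∈ admissible (sfClass 4 L N ε) L (k + 1) (vary flatCfg (τ₀ • A) 1) ∧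
          SmallField U (δ / ((L : ℝ) ^ (k + 1)) ^ 2) ∧
          ∀ φ : Site 4 → Fin 4 → Matrix n n ℂ, IsSkewDir φ → IsPeriodicDir φ ((N * L ^ (k + 1) : ℕ) : ℤ) → TangentIter L k U φ →
            dAction U φ (perWin 4 (N * L ^ (k + 1))) = 0) →
        ∃ ρ : ℝ, 0 < ρ ∧ ∀ τ ∈ Icc (0 : ℝ) 1, |τ - τ₀| < ρ →
          ∃ U : Site 4 → Fin 4 → (Matrix n n ℂ)ˣ, U ∈ admissible (sfClass 4 L N ε) L (k + 1) (vary flatCfg (τ • A) 1) ∧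
            SmallField U (δ / ((L : ℝ) ^ (k + 1)) ^ 2) ∧
            ∀ φ : Site 4 → Fin 4 → Matrix n n ℂ, IsSkewDir φ → IsPeriodicDir φ ((N * L ^ (k + 1) : ℕ) : ℤ) → TangentIter L k U φ →
              dAction U φ (perWin 4 (N * L ^ (k + 1))) = 0)
    (hrepU : ∀ (u : Site 4 → (Matrix n n ℂ)ˣ) (A : Site 4 → Fin 4 → Matrix n n ℂ), IsUnitarySite u → IsPeriodicSite u (N : ℤ) → IsSkewDir A →
      IsPeriodicDir A (N : ℤ) → (∀ (x : Site 4) (κ : Fin 4), ‖A x κ‖ ≤ gaugeConst n * (((N : ℝ))⁻¹ + (N : ℝ) * η)) →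
      gaugeAct u V = vary (flatCfg : Site 4 → Fin 4 → (Matrix n n ℂ)ˣ) A 1 →
      ∀ (k : ℕ) (Us : Site 4 → Fin 4 → (Matrix n n ℂ)ˣ), Us ∈ admissible (sfClass 4 L N ε) L (k + 1) (vary flatCfg A 1) →
        SmallField Us (δ / ((L : ℝ) ^ (k + 1)) ^ 2) →
        (∀ φ : Site 4 → Fin 4 → Matrix n n ℂ, IsSkewDir φ → IsPeriodicDir φ ((N * L ^ (k + 1) : ℕ) : ℤ) → TangentIter L k Us φ →
          dAction Us φ (perWin 4 (N * L ^ (k + 1))) = 0) →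
        ∀ U' ∈ admissible (sfClass 4 L N ε) L (k + 1) (vary flatCfg A 1), ∃ (X XT XN : Site 4 → Fin 4 → Matrix n n ℂ) (α ν κ₁ : ℝ),
          IsSkewDir X ∧ IsPeriodicDir X ((N * L ^ (k + 1) : ℕ) : ℤ) ∧ 0 ≤ α ∧ (∀ x μ, ‖X x μ‖ ≤ α) ∧
          levelAction 4 L N (k + 1) (vary Us X 1) ≤ levelAction 4 L N (k + 1) U' ∧
          SmallField (vary Us X 1) (ε / ((L : ℝ) ^ (k + 1)) ^ 2) ∧
          X = XT + XN ∧ XT ∈ frameFreeBlockLandauW (d := 4) (n := n) L N (k + 1) Us ∧ IsSkewDir XN ∧ 0 ≤ ν ∧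
          energyNormW L (k + 1) Us XN (periodBox (d := 4) (N * L ^ (k + 1)))
            ≤ ν * energyNormW L (k + 1) Us X (periodBox (d := 4) (N * L ^ (k + 1))) ∧
          ε / ((L : ℝ) ^ (k + 1)) ^ 2 * (∑ p ∈ perWin 4 (N * L ^ (k + 1)), ‖curl Us XN p‖)
            ≤ κ₁ * energyNormW L (k + 1) Us X (periodBox (d := 4) (N * L ^ (k + 1))) ^ 2 ∧
          2 * κ₁ ≤ ((((1 / 2 - ν ^ 2) / (2 * (1 + CP)) - ν ^ 2) / 2
              - 576 * (4 : ℕ) * (Real.exp α - 1) ^ 2 * ((L : ℝ) ^ (k + 1)) ^ 2) / (Fintype.card n : ℝ)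
              - 28 * (4 : ℕ) * (ε / ((L : ℝ) ^ (k + 1)) ^ 2 + 7 * α ^ 2) * ((L : ℝ) ^ (k + 1)) ^ 2)) :
    ∀ (k : ℕ) (U₀ : Site 4 → Fin 4 → (Matrix n n ℂ)ˣ), U₀ ∈ admissible (sfClass 4 L N ε) L (k + 1) V →
      SmallField U₀ (δ / ((L : ℝ) ^ k) ^ 2) →
      ∃ U, IsMinimiser 4 (sfClass 4 L N ε) L N (k + 1) V U ∧ SmallField U (δ / ((L : ℝ) ^ (k + 1)) ^ 2) := by
  have hL1 : 1 ≤ L := by omega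
  obtain ⟨u, hu, huP, A, hAs, hAP, hAb, hchart⟩ := exists_expChart_of_sector hN hη hsec hVu hVP hVη
  have h0 : ∀ k : ℕ, ∃ U₀ : Site 4 → Fin 4 → (Matrix n n ℂ)ˣ,
      U₀ ∈ admissible (sfClass 4 L N ε) L (k + 1) (flatCfg : Site 4 → Fin 4 → (Matrix n n ℂ)ˣ) ∧ SmallField U₀ 0 :=
    fun k => ⟨flatCfg, flatCfg_mem_admissible L N hε0 (k + 1), (flat_mem_classes (d := 4) (n := n) le_rfl).2⟩
  have hstep' := oneStep_of_expChart_open_repW (d := 4) hL hN hε0 hε1 hε2 hδ hCP hls hP flatCfg A h0 (hopen u A hu huP hAs hAP hAb hchart)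
    (hrepU u A hu huP hAs hAP hAb hchart)
  rw [← hchart] at hstep'
  exact oneStep_of_oneStep_gaugeAct hL1 hε0 hls hu huP hstep'

/-- **ONE-STEP AT `d = 4`, `L = 2`, SU(2)∕U(2) (`card n = 2`), `0 < ε ≤ 10⁻⁵³`, FOR EVERY SECTOR DATUM, FROM OPEN ∧ REP_w ONLY** — (P♮)_W, the level family and
the class smallness discharged (`classSlicePoincare_SU2'`, `levelSmall_all_d4_L2`, `classSmall_d4_L2`); constant of record `CP = CPLine 4 2 2 10⁻¹⁷ 10⁻⁵³ + 1`.
[folklore] -/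
theorem oneStep_SU2_of_sector_open_repW [Nonempty n] (hn : Fintype.card n = 2) {N : ℕ} [NeZero N] (hN : 1 ≤ N) {ε δ η : ℝ} (hε : 0 < ε)
    (hε' : ε ≤ 1 / 10 ^ 53) (hδ : 0 ≤ δ) (hη : 0 ≤ η) (hsec : (Fintype.card n : ℝ) * (N : ℝ) ^ 2 * η ≤ sectorConst n)
    {V : Site 4 → Fin 4 → (Matrix n n ℂ)ˣ} (hVu : IsUnitaryCfg V) (hVP : IsPeriodicCfg V (N : ℤ)) (hVη : SmallField V η)
    (hopen : ∀ (u : Site 4 → (Matrix n n ℂ)ˣ) (A : Site 4 → Fin 4 → Matrix n n ℂ), IsUnitarySite u → IsPeriodicSite u (N : ℤ) → IsSkewDir A →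
      IsPeriodicDir A (N : ℤ) → (∀ (x : Site 4) (κ : Fin 4), ‖A x κ‖ ≤ gaugeConst n * (((N : ℝ))⁻¹ + (N : ℝ) * η)) →
      gaugeAct u V = vary (flatCfg : Site 4 → Fin 4 → (Matrix n n ℂ)ˣ) A 1 →
      ∀ (k : ℕ), ∀ τ₀ ∈ Icc (0 : ℝ) 1,
        (∃ U : Site 4 → Fin 4 → (Matrix n n ℂ)ˣ, U ∈ admissible (sfClass 4 2 N ε) 2 (k + 1) (vary flatCfg (τ₀ • A) 1) ∧
          SmallField U (δ / ((((2 : ℕ) : ℝ)) ^ (k + 1)) ^ 2) ∧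
          ∀ φ : Site 4 → Fin 4 → Matrix n n ℂ, IsSkewDir φ → IsPeriodicDir φ ((N * 2 ^ (k + 1) : ℕ) : ℤ) → TangentIter 2 k U φ →
            dAction U φ (perWin 4 (N * 2 ^ (k + 1))) = 0) →
        ∃ ρ : ℝ, 0 < ρ ∧ ∀ τ ∈ Icc (0 : ℝ) 1, |τ - τ₀| < ρ →
          ∃ U : Site 4 → Fin 4 → (Matrix n n ℂ)ˣ, U ∈ admissible (sfClass 4 2 N ε) 2 (k + 1) (vary flatCfg (τ • A) 1) ∧
            SmallField U (δ / ((((2 : ℕ) : ℝ)) ^ (k + 1)) ^ 2) ∧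
            ∀ φ : Site 4 → Fin 4 → Matrix n n ℂ, IsSkewDir φ → IsPeriodicDir φ ((N * 2 ^ (k + 1) : ℕ) : ℤ) → TangentIter 2 k U φ →
              dAction U φ (perWin 4 (N * 2 ^ (k + 1))) = 0)
    (hrepU : ∀ (u : Site 4 → (Matrix n n ℂ)ˣ) (A : Site 4 → Fin 4 → Matrix n n ℂ), IsUnitarySite u → IsPeriodicSite u (N : ℤ) → IsSkewDir A →
      IsPeriodicDir A (N : ℤ) → (∀ (x : Site 4) (κ : Fin 4), ‖A x κ‖ ≤ gaugeConst n * (((N : ℝ))⁻¹ + (N : ℝ) * η)) →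
      gaugeAct u V = vary (flatCfg : Site 4 → Fin 4 → (Matrix n n ℂ)ˣ) A 1 →
      ∀ (k : ℕ) (Us : Site 4 → Fin 4 → (Matrix n n ℂ)ˣ), Us ∈ admissible (sfClass 4 2 N ε) 2 (k + 1) (vary flatCfg A 1) →
        SmallField Us (δ / ((((2 : ℕ) : ℝ)) ^ (k + 1)) ^ 2) →
        (∀ φ : Site 4 → Fin 4 → Matrix n n ℂ, IsSkewDir φ → IsPeriodicDir φ ((N * 2 ^ (k + 1) : ℕ) : ℤ) → TangentIter 2 k Us φ →
          dAction Us φ (perWin 4 (N * 2 ^ (k + 1))) = 0) →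
        ∀ U' ∈ admissible (sfClass 4 2 N ε) 2 (k + 1) (vary flatCfg A 1), ∃ (X XT XN : Site 4 → Fin 4 → Matrix n n ℂ) (α ν κ₁ : ℝ),
          IsSkewDir X ∧ IsPeriodicDir X ((N * 2 ^ (k + 1) : ℕ) : ℤ) ∧ 0 ≤ α ∧ (∀ x μ, ‖X x μ‖ ≤ α) ∧
          levelAction 4 2 N (k + 1) (vary Us X 1) ≤ levelAction 4 2 N (k + 1) U' ∧
          SmallField (vary Us X 1) (ε / ((((2 : ℕ) : ℝ)) ^ (k + 1)) ^ 2) ∧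
          X = XT + XN ∧ XT ∈ frameFreeBlockLandauW (d := 4) (n := n) 2 N (k + 1) Us ∧ IsSkewDir XN ∧ 0 ≤ ν ∧
          energyNormW 2 (k + 1) Us XN (periodBox (d := 4) (N * 2 ^ (k + 1)))
            ≤ ν * energyNormW 2 (k + 1) Us X (periodBox (d := 4) (N * 2 ^ (k + 1))) ∧
          ε / ((((2 : ℕ) : ℝ)) ^ (k + 1)) ^ 2 * (∑ p ∈ perWin 4 (N * 2 ^ (k + 1)), ‖curl Us XN p‖)
            ≤ κ₁ * energyNormW 2 (k + 1) Us X (periodBox (d := 4) (N * 2 ^ (k + 1))) ^ 2 ∧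
          2 * κ₁ ≤ ((((1 / 2 - ν ^ 2) / (2 * (1 + (CPLine 4 2 2 (1 / 10 ^ 17) (1 / 10 ^ 53) + 1))) - ν ^ 2) / 2
              - 576 * (4 : ℕ) * (Real.exp α - 1) ^ 2 * ((((2 : ℕ) : ℝ)) ^ (k + 1)) ^ 2) / (Fintype.card n : ℝ)
              - 28 * (4 : ℕ) * (ε / ((((2 : ℕ) : ℝ)) ^ (k + 1)) ^ 2 + 7 * α ^ 2) * ((((2 : ℕ) : ℝ)) ^ (k + 1)) ^ 2)) :
    ∀ (k : ℕ) (U₀ : Site 4 → Fin 4 → (Matrix n n ℂ)ˣ), U₀ ∈ admissible (sfClass 4 2 N ε) 2 (k + 1) V →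
      SmallField U₀ (δ / ((((2 : ℕ) : ℝ)) ^ k) ^ 2) →
      ∃ U, IsMinimiser 4 (sfClass 4 2 N ε) 2 N (k + 1) V U ∧ SmallField U (δ / ((((2 : ℕ) : ℝ)) ^ (k + 1)) ^ 2) := by
  have hP0 := classSlicePoincare_SU2' (n := n) hn hN hε hε'
  have hCP : 0 < CPLine 4 2 2 (1 / 10 ^ 17) (1 / 10 ^ 53) + 1 := by linarith [CPLine_nonneg_d4_L2]
  have hP : ∀ (j : ℕ) (W : Site 4 → Fin 4 → (Matrix n n ℂ)ˣ), W ∈ sfClass 4 2 N ε (j + 1) →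
      SlicePoincare 2 (j + 1) W (frameFreeBlockLandauW 2 N (j + 1) W) (CPLine 4 2 2 (1 / 10 ^ 17) (1 / 10 ^ 53) + 1)
        (periodBox (d := 4) (N * 2 ^ (j + 1))) :=
    fun j W hW => slicePoincare_mono (hP0 j W hW) (by linarith)
  have hls := levelSmall_all_d4_L2 hε.le (hε'.trans (by norm_num))
  obtain ⟨hε1, hε2⟩ := classSmall_d4_L2 hε'
  exact oneStep_of_sector_open_repW (by norm_num) hN hε.le hε1 hε2 hδ hCP hls hP hη hsec hVu hVP hVη hopen hrepU

end

end Summit.QuantumFields.BalabanUV.T4Continuum.NE7OneStepOfSectorOpen
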